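import Literature.AlgebraicGeometry.Motives.HodgeStructureLefschetzGroupInvariantsDivisorClasses
import HarnessLib

/-!
# Milne 1999, Thm. 3.2 DEGREE BY DEGREE: `(⋀^{2p} W)^{S(E,B)} = (D)^p` — the invariant `2p`-vectors are the `K`-span of the
# `p`-fold products of invariant `2`-vectors ("`D^p_{hom}(A)`", the degree-`2p` part of `k[H²(A)^{S(A)}]`), abstractly and on
# `K`-points of a polarized `ℚ`-Hodge structure (divisor `2`-vectors)

[topic AlgebraicGeometry/Motives]

Layer `Literature/AlgebraicGeometry/Motives`, lane `lit-hodgefound` (Track 2 foundations library; seat `lit-hodgefound-p34`,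
generation 25, self-proposed row g25-#5), namespaces `Literature.AlgebraicGeometry.Motives.ExteriorLefschetz` (§1–§3, generic)
and `Literature.AlgebraicGeometry.Motives.HodgeStructure` (§4). THEOREMS ONLY; no definition, no named fact, no `sorry` (D-0026,
net debt `0`).  DEGREEWISE REFINEMENT of the seat's g25-#1 `Milne1999/ExteriorInvariantsGeneratedInDegreeTwo` (whose conclusion
is membership in the `K`-subalgebra `K[S]`, all degrees mixed) in the shape of the tree's degreewise objects — the ℂ-Betti
`Barriers.HodgeConjecture.divisorClassesSpan X g p` ("`Dᵖ ⊗ ℂ` = span of the `p`-fold cup products of divisor classes") and the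
abstract `Motives.HodgeStructure.divisorClasses H p` (`D^{p} = D^{p-1} ∧ B¹`): here the degree-`2p` invariants are placed in
the SUBMODULE POWER `N ^ p` (Mathlib's monoid of submodules of the algebra `⋀ W`) of a submodule `N` of `2`-vectors.

## The source, verbatim

J. S. Milne, *Lefschetz classes on abelian varieties*, Duke Math. J. **96** (1999) 639–675 [`Milne1999LefschetzClasses`, held
`paper:doi-10-1215-s0012-7094-99-09620-5`; PDF page = printed page − 638], p. 653 (p0015): "**Theorem 3.2.** […] the
`k`-algebra `H^*(A^r)^{S(A)}` is generated by divisor classes. […] **Proposition 3.4.** […] `H^*(A^r)^{S(A)} = k[H²(A^r)^{S(A)}]`";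
p. 655 Prop. 3.6: "`(⋀^*(rH))^G = k[(⊗² rH)^G]` all `r ≥ 1`" with its proof (p. 655 L20–L33): "the `G`-invariant tensors are
linear combinations of the forms `φ ⊗ ⋯ ⊗ φ` […] Clearly such a form is a product of `G`-invariant forms in
`(H₁ ⊕ ⋯ ⊕ H_r)^{⊗2}`" — i.e. an invariant of degree `2p` is a combination of products of EXACTLY `p` invariants of degree
`2`; Cor. 4.5 (p. 659): "`H^{2*}(A^r)(*)^{L(A)} = D_{hom}(A^r)_k`" with §4 p. 657 "`D^*_{hom}(A)_k`, the `k`-subalgebra of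
`H^{2*}(A)(*)` generated by the divisor classes", graded by `D^p_{hom}`.

## What is proved

* §1 (generic `⋀ W`) `sum_smul_ιMulti_spPairWord_mem_pow`: the weighted sums over the letters of the contracted pair words with
  `m` pairs lie in `N ^ m` as soon as the crossed `2`-vectors lie in the submodule `N` (twin of g25-#1's `…_mem` for
  subalgebras).
* §2 `mem_pow_of_forall_map_eq_of_letterColouring`: the letter-coloured criterion of g25-#1 §3 with conclusion `x ∈ N ^ p` for
  `x ∈ ⋀^{2p} W` (same proof, word for word).
* §3 **`mem_pow_of_forall_map_eq`** (`K` algebraically closed of characteristic `0`, `B` non-degenerate alternating, `E`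
  semisimple `†`-stable, `G = S(E, B)`): every `G`-invariant `x ∈ ⋀^{2p} W` lies in `(span_K D)^p`, `D` the `G`-invariant
  `2`-vectors; and **`setOf_mem_and_forall_map_eq_eq_span_pow`**: `{x ∈ ⋀^{2p} W | G-invariant} = (span_K D)^p` as sets.
* §4 **on `K`-points of a polarized `ℚ`-Hodge structure of odd weight** (`W = K ⊗_ℚ V`, `S(H)(K)`, `K ⊇ ℚ` algebraically
  closed): `Polarization.setOf_mem_and_forall_lefschetzGroupBaseChange_map_eq_eq_span_pow` (`(⋀^{2p} W)^{S(H)(K)} =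
  (span_K {S(H)(K)-invariant 2-vectors})^p`) and — with Prop. 3.3 covariant (g25-#3) —
  **`Polarization.setOf_mem_and_forall_lefschetzGroupBaseChange_map_eq_eq_span_divisorTwoVectors_pow`**:
  `(⋀^{2p} W)^{S(H)(K)} = (span_K {divisor 2-vectors})^p` ("`H^{2p}(A)^{S(A)} = D^p_{hom}(A)_k`").

NOT here: descent of these statements to `ℚ`-coefficients (`x ∈ ⋀^{2p}_ℚ V` with `x ⊗ 1` invariant ⟹ `x` a `ℚ`-combination
of products of `ℚ`-divisor `2`-vectors; Lemma 3.1 — needs the base change `K ⊗ ⋀_ℚ V ≅ ⋀_K(K ⊗ V)` of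
`LinearAlgebra/Alternating/ExteriorPowerBaseChange` made multiplicative) and the identification of the `ℚ`-divisor `2`-vectors
with the degree-`2` Hodge classes `B¹` of the p02 lineage (`Motives/HodgeStructureExteriorPowerDivisorClasses`).

## References

* [Milne1999LefschetzClasses] J. S. Milne, Lefschetz classes on abelian varieties, Duke Math. J. 96 (1999) 639–675: §3 Thm.
  3.2, Prop. 3.3, Prop. 3.4 (p. 653), Prop. 3.6 and its proof (p. 655), p. 656; §4 p. 657 (`D^*_{hom}`), Cor. 4.5 (p. 659).
* [GoodmanWallachGTM255] R. Goodman, N. R. Wallach, Symmetry, Representations, and Invariants, GTM 255 (2009), §4.1.1,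
  Thm. 5.3.1, Thm. 5.3.3, Thm. 5.3.5.
* [BourbakiAlgebre1a3] N. Bourbaki, Algèbre, Ch. III §7 no. 1 (the graded algebra `⋀ W`, `⋀^p ⋀^q ⊆ ⋀^{p+q}`).
-/

noncomputable section

open scoped BigOperators Matrix TensorProduct
open Literature.AlgebraicGeometry.HodgeTheory (posEquiv)
open Literature.RepresentationTheory.GeneralLinear
open Literature.RepresentationTheory.ClassicalInvariants
open Literature.NumberTheory.DiophantineGeometry
open Literature.AlgebraicGeometry.Milne1999

namespace Literature.AlgebraicGeometry.Motives

namespace ExteriorLefschetz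

/-! ### §1 Contracted pair words lie in the submodule power `N ^ m` -/

section PairWords

variable {K : Type*} [Field K] {W : Type*} [AddCommGroup W] [Module K W] {ι'' : Type*} {n : ℕ}

/-- **The weighted sum over the letters of the contracted pair words with `m` pairs lies in `N ^ m`** whenever the crossed
`2`-vectors `Σ_{a,a'} Θ_c(a,a') · y(I c, a) ∧ y(J c, a')` lie in the submodule `N ⊆ ⋀ W` ("a product of `G`-invariant forms",
one factor per pair — the degreewise twin of `Milne1999.sum_smul_ιMulti_spPairWord_mem`).
[cite: Milne1999LefschetzClasses, Prop. 3.6 and its proof (p. 655 L20–L33), Remark 3.7] [cite: GoodmanWallachGTM255, Thm. 5.3.5] -/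
theorem sum_smul_ιMulti_spPairWord_mem_pow (y : ι'' × Fin n → W) (N : Submodule K (ExteriorAlgebra K W)) :
    ∀ (m : ℕ) (Θ : Fin m → Matrix (Fin n) (Fin n) K) (I J : Fin m → ι''),
      (∀ c, (∑ a : Fin n, ∑ a' : Fin n,
        Θ c a a' • (ExteriorAlgebra.ι K (y (I c, a)) * ExteriorAlgebra.ι K (y (J c, a')))) ∈ N) →
      (∑ lam : Fin m → Fin n × Fin n, (∏ c, Θ c (lam c).1 (lam c).2) •
          ExteriorAlgebra.ιMulti K (2 * m) (spPairWord y I J lam)) ∈ N ^ m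
  | 0, Θ, I, J, _ => by
    rw [Fintype.sum_unique, Finset.univ_eq_empty, Finset.prod_empty, one_smul, pow_zero]
    change ExteriorAlgebra.ιMulti K 0 _ ∈ (1 : Submodule K (ExteriorAlgebra K W))
    rw [ExteriorAlgebra.ιMulti_zero_apply]
    exact Submodule.mem_one.2 ⟨1, map_one _⟩
  | m + 1, Θ, I, J, hθ => by
    have IH := sum_smul_ιMulti_spPairWord_mem_pow y N m (Fin.tail Θ) (Fin.tail I) (Fin.tail J) fun c => hθ c.succ
    have hterm : ∀ (ab : Fin n × Fin n) (lam' : Fin m → Fin n × Fin n),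
        ExteriorAlgebra.ιMulti K (2 * (m + 1)) (spPairWord y I J (Fin.cons ab lam')) =
          ExteriorAlgebra.ι K (y (I 0, ab.1)) * ExteriorAlgebra.ι K (y (J 0, ab.2)) *
            ExteriorAlgebra.ιMulti K (2 * m) (spPairWord y (Fin.tail I) (Fin.tail J) lam') := by
      intro ab lam'
      have hw : spPairWord y I J (Fin.cons ab lam') = (Fin.cons (y (I 0, ab.1)) (Fin.cons (y (J 0, ab.2))
          (spPairWord y (Fin.tail I) (Fin.tail J) lam')) : Fin (2 * m + 1 + 1) → W) := by
        funext q
        rw [spPairWord_succ_apply, Fin.cons_zero, Fin.tail_cons]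
      rw [hw]
      change ExteriorAlgebra.ιMulti K (2 * m + 1 + 1) _ = _
      rw [ιMulti_cons_cons]
    have hsum : (∑ x : (Fin n × Fin n) × (Fin m → Fin n × Fin n),
        (∏ c, Θ c (((Fin.consEquiv fun _ : Fin (m + 1) => Fin n × Fin n) x) c).1
          (((Fin.consEquiv fun _ : Fin (m + 1) => Fin n × Fin n) x) c).2) •
        ExteriorAlgebra.ιMulti K (2 * (m + 1))
          (spPairWord y I J ((Fin.consEquiv fun _ : Fin (m + 1) => Fin n × Fin n) x))) =
        (∑ a : Fin n, ∑ a' : Fin n,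
            Θ 0 a a' • (ExteriorAlgebra.ι K (y (I 0, a)) * ExteriorAlgebra.ι K (y (J 0, a')))) *
          (∑ lam' : Fin m → Fin n × Fin n, (∏ c, Fin.tail Θ c (lam' c).1 (lam' c).2) •
            ExteriorAlgebra.ιMulti K (2 * m) (spPairWord y (Fin.tail I) (Fin.tail J) lam')) := by
      rw [Fintype.sum_prod_type, ← Fintype.sum_prod_type' (fun a a' => Θ 0 a a' •
          (ExteriorAlgebra.ι K (y (I 0, a)) * ExteriorAlgebra.ι K (y (J 0, a')))), Finset.sum_mul]
      refine Finset.sum_congr rfl fun ab _ => ?_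
      rw [Finset.mul_sum]
      refine Finset.sum_congr rfl fun lam' _ => ?_
      have hce : (Fin.consEquiv fun _ : Fin (m + 1) => Fin n × Fin n) (ab, lam') = Fin.cons ab lam' := rfl
      rw [hce, Fin.prod_univ_succ, Fin.cons_zero]
      simp only [Fin.cons_succ]
      rw [hterm ab lam', smul_mul_smul_comm]
      rfl
    rw [← (Fin.consEquiv fun _ : Fin (m + 1) => Fin n × Fin n).sum_comp, hsum, pow_succ']
    exact Submodule.mul_mem_mul (hθ 0) IH

end PairWords

/-! ### §2 The letter-coloured criterion on `⋀ W`, degreewise -/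

section LetterColoured

/-- Matrices which are the identity off the letters of colour `i` are colour-preserving: an entry between letters of
different colours vanishes. [cite: Milne1999LefschetzClasses, §3 p. 656] -/
private theorem entry_eq_zero_of_lcol_ne'' {K : Type*} [Field K] {ι : Type} {N : ℕ} (lcol : Fin N → ι) (i : ι)
    (g : Matrix (Fin N) (Fin N) K)
    (hg : ∀ j j', (lcol j ≠ i ∨ lcol j' ≠ i) → g j' j = (1 : Matrix (Fin N) (Fin N) K) j' j)
    {j j' : Fin N} (h : lcol j' ≠ lcol j) : g j' j = 0 := by
  have hne : j' ≠ j := fun hh => h (by rw [hh])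
  by_cases hj : lcol j = i
  · rw [hg j j' (Or.inr (by rw [← hj]; exact h)), Matrix.one_apply, if_neg hne]
  · rw [hg j j' (Or.inl hj), Matrix.one_apply, if_neg hne]

variable {K : Type*} [Field K] [CharZero K] {W : Type*} [AddCommGroup W] [Module K W]
  {ι : Type} [Fintype ι] [DecidableEq ι] {N : ℕ}

/-- **Milne 1999, Prop. 3.4 with Prop. 3.6, letter-coloured and DEGREEWISE on `⋀ W`**: as g25-#1's
`Milne1999.mem_adjoin_of_forall_map_eq_of_letterColouring`, but with a SUBMODULE `N ⊆ ⋀ W` containing the kernel `2`-vectors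
and the conclusion `x ∈ N ^ p` for a `G`-invariant `x ∈ ⋀^{2p} W` — "such a form is a product of `G`-invariant forms", one per
pair, `p` pairs in degree `2p`. Proof word for word that of g25-#1 §3 (antisymmetric coefficients, invariant slices, colour
patterns, the letter-coloured FFT `ClassicalInvariants.mem_span_pairContraction_of_invariant_aux`, evaluation of the pair
contractions by §1). [cite: Milne1999LefschetzClasses, Prop. 3.4 (p. 653), Prop. 3.6 and its proof (p. 655), p. 656]
[cite: GoodmanWallachGTM255, §4.1.1, Thm. 5.3.1, Thm. 5.3.3 and Thm. 5.3.5] -/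
theorem mem_pow_of_forall_map_eq_of_letterColouring
    (b : Module.Basis (Fin N) K W) (lcol : Fin N → ι) (grp ker : ι → Set (Matrix (Fin N) (Fin N) K))
    (hone : ∀ (i : ι) (P : Type) [Fintype P] [DecidableEq P] (c : (P → Fin N) → K),
      (∀ w, (∃ q, lcol (w q) ≠ i) → c w = 0) →
      (∀ g ∈ grp i, ∀ w' : P → Fin N, (∑ w, (∏ q, g (w' q) (w q)) * c w) = c w') →
      c ∈ Submodule.span K {f : (P → Fin N) → K |
        ∃ (k : ℕ) (e : P ≃ Fin 2 × Fin k) (M : Fin k → Matrix (Fin N) (Fin N) K),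
          (∀ m, M m ∈ ker i) ∧ f = pairContraction M e})
    (hgrp : ∀ i, ∀ g ∈ grp i, ∀ j j', (lcol j ≠ i ∨ lcol j' ≠ i) → g j' j = (1 : Matrix (Fin N) (Fin N) K) j' j)
    (G : Subgroup (W ≃ₗ[K] W)) (hG : ∀ i, ∀ g ∈ grp i, ∃ u ∈ G, ∀ j, u (b j) = ∑ j', g j' j • b j')
    (T : Submodule K (ExteriorAlgebra K W))
    (hker : ∀ i, ∀ M ∈ ker i,
      (∑ j, ∑ j', M j j' • (ExteriorAlgebra.ι K (b j) * ExteriorAlgebra.ι K (b j'))) ∈ T)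
    (p : ℕ) {x : ExteriorAlgebra K W} (hxm : x ∈ ⋀[K]^(2 * p) W)
    (hx : ∀ u ∈ G, ExteriorAlgebra.map (u : W →ₗ[K] W) x = x) :
    x ∈ T ^ p := by
  classical
  set F := ExteriorAlgebra.ιMulti K (2 * p) (M := W) with hF
  -- the basis, reindexed by `PUnit × Fin N` (one slot) to use the slice machinery of the tree
  let eU : Fin N ≃ Unit × Fin N := ⟨fun ℓ => ((), ℓ), fun q => q.2, fun _ => rfl, fun _ => rfl⟩
  let b' : Module.Basis (Unit × Fin N) K W := b.reindex eU
  have hb' : ∀ (s : Unit) (ℓ : Fin N), b' (s, ℓ) = b ℓ := fun s ℓ => by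
    rw [Module.Basis.reindex_apply]
    rfl
  obtain ⟨a, ha, hax⟩ := exists_isAntisymm_wordEval_ιMulti_eq b' hxm
  -- every slice is invariant under the Kronecker powers of every `g ∈ grp i`
  have hinv : ∀ (t : Fin (2 * p) → Unit) (i : ι), ∀ g ∈ grp i,
      wordRepAt K (fun _ => g) (wordSlice a t) = wordSlice a t := by
    intro t i g hg
    obtain ⟨u, huG, hu⟩ := hG i g hg
    exact wordRepAt_wordSlice_eq_of_map_wordEval_eq b' ha (u : W →ₗ[K] W) (fun _ => g)
      (fun s ℓ => by rw [hb']; simp_rw [hb']; exact hu ℓ) (by rw [hax]; exact hx u huG) t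
  rw [← hax, wordEval_eq_sum_wordSlice]
  refine Submodule.sum_mem _ fun t _ => ?_
  set c := wordSlice a t with hc
  have hcinv : ∀ i, ∀ g ∈ grp i, ∀ w' : Word N (2 * p), ∑ w, (∏ q, g (w' q) (w q)) * c w = c w' := by
    intro i g hg w'
    have h := congrFun (hinv t i g hg) w'
    rwa [wordRepAt_apply] at h
  -- the pieces of `c` along the colour patterns of the words
  let piece : (Fin (2 * p) → ι) → Word N (2 * p) → K := fun κ w => if lcol ∘ w = κ then c w else 0
  have hsum : c = ∑ κ, piece κ := by
    funext w
    rw [Finset.sum_apply]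
    simp only [piece]
    rw [Finset.sum_ite_eq, if_pos (Finset.mem_univ _)]
  have hsupp : ∀ κ (w : Word N (2 * p)), (∃ q, lcol (w q) ≠ κ q) → piece κ w = 0 := by
    rintro κ w ⟨q, hq⟩
    simp only [piece]
    rw [if_neg]
    intro h
    exact hq (congrFun h q)
  -- each piece is invariant, colour by colour
  have hpinv : ∀ (κ : Fin (2 * p) → ι) (i : ι), ∀ g ∈ grp i, ∀ w' : Word N (2 * p),
      (∑ w, (∏ q, (if κ q = i then g else 1) (w' q) (w q)) * piece κ w) = piece κ w' := by
    intro κ i g hg w'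
    have hg' := hgrp i g hg
    by_cases hw' : lcol ∘ w' = κ
    · have hRp : piece κ w' = c w' := if_pos hw'
      rw [hRp, ← hcinv i g hg w']
      refine Finset.sum_congr rfl fun w _ => ?_
      by_cases hw : lcol ∘ w = κ
      · have hL : piece κ w = c w := if_pos hw
        rw [hL]
        congr 1
        refine Finset.prod_congr rfl fun q _ => ?_
        by_cases hq : κ q = i
        · rw [if_pos hq]
        · rw [if_neg hq]
          have h1 : lcol (w q) ≠ i := by rw [show lcol (w q) = κ q from congrFun hw q]; exact hq
          rw [hg' _ _ (Or.inl h1)]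
      · have hL : piece κ w = 0 := if_neg hw
        rw [hL, mul_zero]
        obtain ⟨q, hq⟩ : ∃ q, lcol (w q) ≠ κ q := by
          by_contra hall
          push Not at hall
          exact hw (funext hall)
        have hne : lcol (w' q) ≠ lcol (w q) := by
          rw [show lcol (w' q) = κ q from congrFun hw' q]; exact fun h => hq h.symm
        rw [Finset.prod_eq_zero (Finset.mem_univ q) (entry_eq_zero_of_lcol_ne'' lcol i g hg' hne), zero_mul]
    · have hRp : piece κ w' = 0 := if_neg hw'
      rw [hRp]
      refine Finset.sum_eq_zero fun w _ => ?_
      by_cases hw : lcol ∘ w = κ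
      · obtain ⟨q, hq⟩ : ∃ q, lcol (w' q) ≠ κ q := by
          by_contra hall
          push Not at hall
          exact hw' (funext hall)
        have hne : lcol (w' q) ≠ lcol (w q) := by
          rw [show lcol (w q) = κ q from congrFun hw q]; exact hq
        have h0 : (if κ q = i then g else 1) (w' q) (w q) = 0 := by
          by_cases hqi : κ q = i
          · rw [if_pos hqi]; exact entry_eq_zero_of_lcol_ne'' lcol i g hg' hne
          · rw [if_neg hqi, Matrix.one_apply, if_neg]
            intro h; exact hne (by rw [h])
        rw [Finset.prod_eq_zero (Finset.mem_univ q) h0, zero_mul]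
      · rw [show piece κ w = 0 from if_neg hw, mul_zero]
  -- the letter-coloured FFT, piece by piece
  have hmem : ∀ κ : Fin (2 * p) → ι, piece κ ∈ Submodule.span K {f : Word N (2 * p) → K |
      ∃ (k : ℕ) (e : Fin (2 * p) ≃ Fin 2 × Fin k) (M : Fin k → Matrix (Fin N) (Fin N) K),
        (∀ m, κ (e.symm (0, m)) = κ (e.symm (1, m)) ∧ M m ∈ ker (κ (e.symm (0, m)))) ∧
          f = pairContraction M e} :=
    fun κ => mem_span_pairContraction_of_invariant_aux lcol grp ker hone (2 * p) (Fin (2 * p)) κ (piece κ)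
      (Fintype.card_fin _) (hsupp κ) (hpinv κ)
  -- evaluation on the basis
  set Λ := Fintype.linearCombination K (fun ε : Word N (2 * p) => F (fun q => b' (t q, ε q))) with hΛ
  have hΛapply : ∀ c' : Word N (2 * p) → K, Λ c' = ∑ ε, c' ε • F (fun q => b' (t q, ε q)) :=
    fun c' => Fintype.linearCombination_apply K _ c'
  rw [← hΛapply, hsum, map_sum]
  refine Submodule.sum_mem _ fun κ _ => ?_
  refine (Submodule.span_le (p := (T ^ p).comap Λ)).2 ?_ (hmem κ)
  rintro _ ⟨k, e, M, he, rfl⟩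
  rw [SetLike.mem_coe, Submodule.mem_comap, hΛapply]
  have hk : k = p := by
    have h := Fintype.card_congr e
    simp only [Fintype.card_fin, Fintype.card_prod] at h
    omega
  subst hk
  have hpc : pairContraction M e = colouredContraction M (fun q => (e q).2) e := by
    funext w
    rw [pairContraction_apply, colouredContraction_apply]
    refine Finset.prod_congr rfl fun m _ => ?_
    rw [Equiv.apply_symm_apply]
  rw [hpc]
  obtain ⟨π, -, hs⟩ := sum_colouredContraction_smul_eq F M (fun q => (e q).2) e (⇑b') t
  rw [hs]
  refine Submodule.smul_mem _ _ ?_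
  refine sum_smul_ιMulti_spPairWord_mem_pow (⇑b') T k (fun m => M (e (e.symm (0, m))).2) _ _ fun m => ?_
  simp_rw [Equiv.apply_symm_apply, hb']
  exact hker _ (M m) (he m).2


end LetterColoured

/-! ### §3 Main theorem, degreewise: `(⋀^{2p} W)^{S(E,B)} = (span_K D)^p` -/

section Main

variable {K : Type*} [Field K] [CharZero K] [IsAlgClosed K] {W : Type*} [AddCommGroup W] [Module K W]
  [FiniteDimensional K W]

/-- **Milne 1999, Prop. 3.4 + Prop. 3.6 DEGREEWISE, abstract form: `(⋀^{2p} W)^{S(E,B)} ⊆ (span_K D)^p`**, `D` the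
`S(E, B)`-invariant `2`-vectors — every `G`-invariant `x ∈ ⋀^{2p} W` is a `K`-combination of products `y₁ ⋯ y_p` of
invariant `2`-vectors (hypotheses as in g25-#1's `Milne1999.mem_adjoin_of_forall_map_eq`: `K` algebraically closed of
characteristic `0`, `B` non-degenerate alternating, `E` semisimple `†`-stable, `hG` the membership test of `G = S(E, B)`).
Proof = that of g25-#1 §5, the adapted letter colouring feeding §2 with `N = span_K D`.
[cite: Milne1999LefschetzClasses, Thm. 3.2, Prop. 3.4 (p. 653), §2 pp. 645–651, Prop. 3.6 (p. 655), p. 656; §4 p. 657 and Cor. 4.5 (p. 659)]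
[cite: GoodmanWallachGTM255, Thm. 5.3.1, Thm. 5.3.3 and Thm. 5.3.5] -/
theorem mem_span_pow_of_forall_map_eq {B : LinearMap.BilinForm K W} (hB : B.Nondegenerate) (hBa : B.IsAlt)
    (E : Subalgebra K (Module.End K W)) [IsSemisimpleRing E]
    (hE : ∀ X ∈ E, ∃ Y ∈ E, ∀ v w, B (Y v) w = B v (X w))
    (G : Subgroup (W ≃ₗ[K] W))
    (hG : ∀ u : W ≃ₗ[K] W, u ∈ G ↔ (∀ X ∈ E, ∀ v, X (u v) = u (X v)) ∧ ∀ v w, B (u v) (u w) = B v w)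
    (p : ℕ) {x : ExteriorAlgebra K W} (hxm : x ∈ ⋀[K]^(2 * p) W)
    (hx : ∀ u ∈ G, ExteriorAlgebra.map (u : W →ₗ[K] W) x = x) :
    x ∈ Submodule.span K {y : ExteriorAlgebra K W |
      y ∈ ⋀[K]^2 W ∧ ∀ u ∈ G, ExteriorAlgebra.map (u : W →ₗ[K] W) y = y} ^ p := by
  classical
  obtain ⟨C⟩ := exists_adaptedColouring_of_isAlgClosed B hB hBa E hE
  letI := C.instFintype
  letI := C.instDecEq
  letI := C.instDec
  have hsq : ∀ a : K, IsSquare a := fun a => IsAlgClosed.exists_eq_mul_self a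
  refine mem_pow_of_forall_map_eq_of_letterColouring C.β C.lcol
    (fun i => if C.IsForm i then formBlockGroup (C.ltr i) (C.Ω i) else glBlockGroup (C.ltr i) (C.ltr₁ i))
    (fun i => if C.IsForm i then formBlockKernels (C.ltr i) (C.Ω i) else glBlockKernels (C.ltr i) (C.ltr₁ i))
    ?_ ?_ G ?_ _ ?_ p hxm hx
  · -- the one-colour first fundamental theorems (Prop. 3.6 (a), (b), (c))
    intro i P _ _ c hsupp hc
    by_cases hi : C.IsForm i
    · simp only [if_pos hi] at hc ⊢
      refine mem_span_pairContraction_of_formBlock_invariant hsq (C.ltr_injective i hi)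
        (C.Ω_isAlt_or_isSymm i hi) (C.Ω_nondegenerate i hi) P c (fun w hw => hsupp w ?_) hc
      obtain ⟨q, hq⟩ := hw
      refine ⟨q, fun h => hq ?_⟩
      rw [C.range_ltr i hi]
      exact h
    · simp only [if_neg hi] at hc ⊢
      refine mem_span_pairContraction_of_glBlock_invariant (C.sum_injective i hi) P c (fun w hw => hsupp w ?_) hc
      obtain ⟨q, hq1, hq2⟩ := hw
      refine ⟨q, fun h => ?_⟩
      have hq : w q ∈ Set.range (C.ltr i) ∪ Set.range (C.ltr₁ i) := by
        rw [C.range_union i hi]; exact h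
      exact hq.elim hq1 hq2
  · -- block group matrices are the identity off their colour
    intro i g hg j j' hjj'
    by_cases hi : C.IsForm i
    · simp only [if_pos hi] at hg
      obtain ⟨_, _, _, h3, h4⟩ := hg
      rcases hjj' with h | h
      · exact h3 _ _ (by rw [C.range_ltr i hi]; exact h)
      · exact h4 _ _ (by rw [C.range_ltr i hi]; exact h)
    · simp only [if_neg hi] at hg
      obtain ⟨_, _, _, _, _, h5, h6⟩ := hg
      rcases hjj' with h | h
      · have hn : j ∉ Set.range (C.ltr i) ∪ Set.range (C.ltr₁ i) := by rw [C.range_union i hi]; exact h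
        exact h5 _ _ (fun hh => hn (Or.inl hh)) (fun hh => hn (Or.inr hh))
      · have hn : j' ∉ Set.range (C.ltr i) ∪ Set.range (C.ltr₁ i) := by rw [C.range_union i hi]; exact h
        exact h6 _ _ (fun hh => hn (Or.inl hh)) (fun hh => hn (Or.inr hh))
  · -- block group elements are `E`-linear `B`-isometries, hence realised in `G = S(E, B)`
    intro i g hg
    have key : (∀ X ∈ E, X * Matrix.toLin C.β C.β g = Matrix.toLin C.β C.β g * X) ∧
        ∀ v w, B (Matrix.toLin C.β C.β g v) (Matrix.toLin C.β C.β g w) = B v w := by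
      by_cases hi : C.IsForm i
      · simp only [if_pos hi] at hg
        exact C.form_group i hi g hg
      · simp only [if_neg hi] at hg
        exact C.pair_group i hi g hg
    obtain ⟨hcomm, hiso⟩ := key
    set T := Matrix.toLin C.β C.β g with hT
    have hinj : Function.Injective T := by
      intro v v' hvv
      rw [← sub_eq_zero]
      refine hB.1 _ fun w => ?_
      rw [← hiso, map_sub, hvv, sub_self, LinearMap.BilinForm.zero_left]
    let u : W ≃ₗ[K] W := LinearEquiv.ofBijective T ⟨hinj, LinearMap.surjective_of_injective hinj⟩
    have hu : ∀ v, u v = T v := fun v => rfl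
    refine ⟨u, (hG u).2 ⟨fun X hX v => ?_, fun v w => ?_⟩, fun j => ?_⟩
    · have h := LinearMap.congr_fun (hcomm X hX) v
      rw [Module.End.mul_apply, Module.End.mul_apply] at h
      rw [hu, hu]
      exact h
    · rw [hu, hu, hiso]
    · rw [hu, hT, Matrix.toLin_self]
  · -- kernel `2`-vectors have operators in `E`, hence are `G`-invariant (§4)
    intro i M hM
    have key : ∃ X ∈ E, ∀ v,
        X v = ∑ j, ∑ j', M j j' • (B v (C.β j') • C.β j - B v (C.β j) • C.β j') := by
      by_cases hi : C.IsForm i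
      · simp only [if_pos hi] at hM
        exact C.form_kernel i hi M hM
      · simp only [if_neg hi] at hM
        exact C.pair_kernel i hi M hM
    obtain ⟨X, hXm, hXv⟩ := key
    refine Submodule.subset_span ⟨sum_smul_ι_mul_ι_mem_exteriorPower_two _ M, fun u hu => ?_⟩
    obtain ⟨hc, hi⟩ := (hG u).1 hu
    exact map_kernelTwoVector_eq hB _ M hXv u (fun v => hc X hXm v) hi

/-- `(span_K D)^p ⊆ ⋀^{2p} W` for any set `D` of `2`-vectors (`⋀² ⋯ ⋀² ⊆ ⋀^{2p}`). [cite: BourbakiAlgebre1a3, Ch. III §7 no. 1] -/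
theorem span_pow_le_exteriorPower {K : Type*} [Field K] {W : Type*} [AddCommGroup W] [Module K W]
    {D : Set (ExteriorAlgebra K W)} (hD : D ⊆ ⋀[K]^2 W) :
    ∀ p : ℕ, Submodule.span K D ^ p ≤ ⋀[K]^(2 * p) W
  | 0 => by
    rw [pow_zero, mul_zero, ExteriorAlgebra.exteriorPower, pow_zero]
  | p + 1 => by
    have h2 : Submodule.span K D ≤ LinearMap.range (ExteriorAlgebra.ι K (M := W)) ^ 2 := Submodule.span_le.2 hD
    have hp : Submodule.span K D ^ p ≤ LinearMap.range (ExteriorAlgebra.ι K (M := W)) ^ (2 * p) :=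
      span_pow_le_exteriorPower hD p
    rw [pow_succ, ExteriorAlgebra.exteriorPower, mul_add, mul_one, pow_add]
    exact mul_le_mul' hp h2

/-- Elements of `(span_K D)^p` are `G`-invariant when the elements of `D` are (products and combinations of invariants; `⋀(u)`
is an algebra map). [cite: BourbakiAlgebre1a3, Ch. III §7 no. 2] -/
theorem map_eq_of_mem_span_pow {K : Type*} [Field K] {W : Type*} [AddCommGroup W] [Module K W]
    (u : W →ₗ[K] W) {D : Set (ExteriorAlgebra K W)} (hD : ∀ y ∈ D, ExteriorAlgebra.map u y = y) :
    ∀ (p : ℕ), ∀ x ∈ Submodule.span K D ^ p, ExteriorAlgebra.map u x = x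
  | 0, x, hx => by
    rw [pow_zero] at hx
    obtain ⟨r, rfl⟩ := Submodule.mem_one.1 hx
    exact AlgHom.commutes _ r
  | p + 1, x, hx => by
    rw [pow_succ] at hx
    refine Submodule.mul_induction_on hx (fun y hy z hz => ?_) (fun y z hy hz => by rw [map_add, hy, hz])
    rw [map_mul, map_eq_of_mem_span_pow u hD p y hy]
    congr 1
    refine Submodule.span_induction (fun w hw => hD w hw) (by rw [map_zero])
      (fun a b _ _ ha hb => by rw [map_add, ha, hb]) (fun c a _ ha => by rw [map_smul, ha]) hz

/-- **`(⋀^{2p} W)^{S(E,B)} = (span_K D)^p` as sets** (`D` the invariant `2`-vectors): the degree-`2p` invariants ARE the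
`p`-fold products of degree-`2` invariants, combined `K`-linearly ("`H^{2p}(A)^{S(A)} = D^p_{hom}(A)_k`").
[cite: Milne1999LefschetzClasses, Thm. 3.2, Prop. 3.4 (p. 653); §4 p. 657 and Cor. 4.5 (p. 659)] -/
theorem setOf_mem_and_forall_map_eq_eq_span_pow {B : LinearMap.BilinForm K W} (hB : B.Nondegenerate) (hBa : B.IsAlt)
    (E : Subalgebra K (Module.End K W)) [IsSemisimpleRing E]
    (hE : ∀ X ∈ E, ∃ Y ∈ E, ∀ v w, B (Y v) w = B v (X w))
    (G : Subgroup (W ≃ₗ[K] W))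
    (hG : ∀ u : W ≃ₗ[K] W, u ∈ G ↔ (∀ X ∈ E, ∀ v, X (u v) = u (X v)) ∧ ∀ v w, B (u v) (u w) = B v w) (p : ℕ) :
    {x : ExteriorAlgebra K W | x ∈ ⋀[K]^(2 * p) W ∧ ∀ u ∈ G, ExteriorAlgebra.map (u : W →ₗ[K] W) x = x} =
      ↑(Submodule.span K {y : ExteriorAlgebra K W |
        y ∈ ⋀[K]^2 W ∧ ∀ u ∈ G, ExteriorAlgebra.map (u : W →ₗ[K] W) y = y} ^ p) := by
  refine Set.Subset.antisymm (fun x hx => mem_span_pow_of_forall_map_eq hB hBa E hE G hG p hx.1 hx.2) fun x hx => ⟨?_, ?_⟩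
  · exact span_pow_le_exteriorPower (fun y hy => hy.1) p hx
  · intro u hu
    exact map_eq_of_mem_span_pow (u : W →ₗ[K] W) (fun y hy => hy.2 u hu) p x hx

end Main

end ExteriorLefschetz

/-! ### §4 On `K`-points of a polarized `ℚ`-Hodge structure: `(⋀^{2p}(K ⊗ V))^{S(H)(K)} = (span_K {divisor 2-vectors})^p` -/

namespace HodgeStructure

open ExteriorLefschetz

universe u uK

variable (K : Type uK) [Field K] [Algebra ℚ K] {V : Type u} [AddCommGroup V] [Module ℚ V] [Module.Finite ℚ V] {n : ℤ}
  {H : HodgeStructure V n} (Q : Polarization H)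

set_option maxSynthPendingDepth 4 in
/-- **Prop. 3.4 DEGREEWISE on `K`-points** (odd weight, `K ⊇ ℚ` algebraically closed): the `S(H)(K)`-invariant
`2p`-vectors of `⋀^{2p}(K ⊗ V)` are exactly the `K`-span of the `p`-fold products of `S(H)(K)`-invariant `2`-vectors.
[cite: Milne1999LefschetzClasses, Thm. 3.2, Prop. 3.4 (p. 653); Cor. 4.5 (p. 659)] -/
theorem Polarization.setOf_mem_and_forall_lefschetzGroupBaseChange_map_eq_eq_span_pow [IsAlgClosed K] (hn : Odd n)
    (p : ℕ) :
    {x : ExteriorAlgebra K (K ⊗[ℚ] V) | x ∈ ⋀[K]^(2 * p) (K ⊗[ℚ] V) ∧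
        ∀ γ ∈ Q.lefschetzGroupBaseChange K, ExteriorAlgebra.map (γ : (K ⊗[ℚ] V) →ₗ[K] (K ⊗[ℚ] V)) x = x} =
      ↑(Submodule.span K {y : ExteriorAlgebra K (K ⊗[ℚ] V) | y ∈ ⋀[K]^2 (K ⊗[ℚ] V) ∧
        ∀ γ ∈ Q.lefschetzGroupBaseChange K, ExteriorAlgebra.map (γ : (K ⊗[ℚ] V) →ₗ[K] (K ⊗[ℚ] V)) y = y} ^ p) := by
  haveI : CharZero K := charZero_of_injective_algebraMap (algebraMap ℚ K).injective
  haveI := isSemisimpleRing_adjoin_baseChange_endAlg K H ⟨Q⟩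
  exact setOf_mem_and_forall_map_eq_eq_span_pow (Q.baseChange_form_nondegenerate K) (Q.baseChange_form_isAlt_of_odd K hn)
    (Algebra.adjoin K (Set.range fun a : H.endAlg ↦ (a : Module.End ℚ V).baseChange K))
    (fun X hX ↦ Q.exists_mem_adjoin_baseChange_form_apply K hX) (Q.lefschetzGroupBaseChange K)
    (fun γ ↦ Q.mem_lefschetzGroupBaseChange_iff_forall_adjoin K γ) p

/-- **The `K`-span of the `S(H)(K)`-invariant `2`-vectors is the `K`-span of the divisor `2`-vectors** (Prop. 3.3 covariant,
the seat's g25-#3, every field `K ⊇ ℚ`, odd weight). [cite: Milne1999LefschetzClasses, Prop. 3.3 (p. 653)] -/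
theorem Polarization.span_setOf_forall_lefschetzGroupBaseChange_map_eq_eq_span_divisorTwoVectors (hn : Odd n) :
    Submodule.span K {y : ExteriorAlgebra K (K ⊗[ℚ] V) | y ∈ ⋀[K]^2 (K ⊗[ℚ] V) ∧
        ∀ γ ∈ Q.lefschetzGroupBaseChange K, ExteriorAlgebra.map (γ : (K ⊗[ℚ] V) →ₗ[K] (K ⊗[ℚ] V)) y = y} =
      Submodule.span K {y' : ExteriorAlgebra K (K ⊗[ℚ] V) | y' ∈ ⋀[K]^2 (K ⊗[ℚ] V) ∧ ∃ a ∈ H.endAlg, Q.adjoint a = a ∧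
        ∀ v w, contractionForm y' (Q.form.baseChange K v) (Q.form.baseChange K w) =
          LinearMap.BilinForm.baseChange K (Q.form ∘ₗ a) v w} := by
  refine le_antisymm (Submodule.span_le.2 fun y hy ↦ ?_) (Submodule.span_mono fun y' hy' ↦ ?_)
  · exact (Q.forall_lefschetzGroupBaseChange_map_eq_iff_mem_span_divisorTwoVectors K hn hy.1).1 hy.2
  · obtain ⟨hy'2, a, ha, ha', hy'ψ⟩ := hy'
    obtain ⟨ya, -, -, hinv, huniq⟩ :=
      Q.exists_mem_exteriorPower_two_forall_contractionForm_apply_eq_baseChange K hn ha ha'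
    exact ⟨hy'2, fun γ hγ ↦ by rw [huniq y' hy'2 hy'ψ]; exact hinv γ hγ⟩

set_option maxSynthPendingDepth 4 in
/-- **Milne 1999, Thm. 3.2 DEGREEWISE on `K`-points, "`H^{2p}(A)^{S(A)} = D^p_{hom}(A)_k`"**: for a polarized `ℚ`-Hodge structure
of odd weight and `K ⊇ ℚ` algebraically closed, the `S(H)(K)`-invariant elements of `⋀^{2p}(K ⊗ V)` are exactly the `K`-span
of the `p`-fold products `y_{a₁} ⋯ y_{a_p}` of divisor `2`-vectors (`aᵢ ∈ E_φ`, `aᵢ† = aᵢ`) — the degree-`2p` Lefschetz classes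
with coefficients in `K`. [cite: Milne1999LefschetzClasses, Thm. 3.2, Prop. 3.3, Prop. 3.4 (p. 653); §4 p. 657 and Cor. 4.5 (p. 659)]
[cite: MumfordAV1970, §21 Application III p. 208] -/
theorem Polarization.setOf_mem_and_forall_lefschetzGroupBaseChange_map_eq_eq_span_divisorTwoVectors_pow [IsAlgClosed K]
    (hn : Odd n) (p : ℕ) :
    {x : ExteriorAlgebra K (K ⊗[ℚ] V) | x ∈ ⋀[K]^(2 * p) (K ⊗[ℚ] V) ∧
        ∀ γ ∈ Q.lefschetzGroupBaseChange K, ExteriorAlgebra.map (γ : (K ⊗[ℚ] V) →ₗ[K] (K ⊗[ℚ] V)) x = x} =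
      ↑(Submodule.span K {y' : ExteriorAlgebra K (K ⊗[ℚ] V) | y' ∈ ⋀[K]^2 (K ⊗[ℚ] V) ∧ ∃ a ∈ H.endAlg, Q.adjoint a = a ∧
        ∀ v w, contractionForm y' (Q.form.baseChange K v) (Q.form.baseChange K w) =
          LinearMap.BilinForm.baseChange K (Q.form ∘ₗ a) v w} ^ p) := by
  rw [Q.setOf_mem_and_forall_lefschetzGroupBaseChange_map_eq_eq_span_pow K hn p,
    Q.span_setOf_forall_lefschetzGroupBaseChange_map_eq_eq_span_divisorTwoVectors K hn]

set_option maxSynthPendingDepth 4 in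
/-- Membership form: an `S(H)(K)`-invariant `x ∈ ⋀^{2p}(K ⊗ V)` is a `K`-combination of `p`-fold products of divisor
`2`-vectors. [cite: Milne1999LefschetzClasses, Thm. 3.2 (p. 653); Cor. 4.5 (p. 659)] -/
theorem Polarization.mem_span_divisorTwoVectors_pow_of_forall_lefschetzGroupBaseChange_map_eq [IsAlgClosed K] (hn : Odd n)
    {p : ℕ} {x : ExteriorAlgebra K (K ⊗[ℚ] V)} (hxm : x ∈ ⋀[K]^(2 * p) (K ⊗[ℚ] V))
    (hx : ∀ γ ∈ Q.lefschetzGroupBaseChange K, ExteriorAlgebra.map (γ : (K ⊗[ℚ] V) →ₗ[K] (K ⊗[ℚ] V)) x = x) :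
    x ∈ Submodule.span K {y' : ExteriorAlgebra K (K ⊗[ℚ] V) | y' ∈ ⋀[K]^2 (K ⊗[ℚ] V) ∧ ∃ a ∈ H.endAlg, Q.adjoint a = a ∧
        ∀ v w, contractionForm y' (Q.form.baseChange K v) (Q.form.baseChange K w) =
          LinearMap.BilinForm.baseChange K (Q.form ∘ₗ a) v w} ^ p := by
  have h : x ∈ {x : ExteriorAlgebra K (K ⊗[ℚ] V) | x ∈ ⋀[K]^(2 * p) (K ⊗[ℚ] V) ∧
      ∀ γ ∈ Q.lefschetzGroupBaseChange K, ExteriorAlgebra.map (γ : (K ⊗[ℚ] V) →ₗ[K] (K ⊗[ℚ] V)) x = x} := ⟨hxm, hx⟩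
  rw [Q.setOf_mem_and_forall_lefschetzGroupBaseChange_map_eq_eq_span_divisorTwoVectors_pow K hn p] at h
  exact h

end HodgeStructure

end Literature.AlgebraicGeometry.Motives

end
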